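import Summits.QuantumFields.BalabanUV.Beta.D1BFx.ColumnGaugeSecondOrder
import Summits.QuantumFields.BalabanUV.Beta.SymCorrectorMixedGauge

/-!
# `BalabanUV.Beta.D1BFx.DressedMixVertexSplit` — road «BF-x» for binder row D1, slot (K), PART 24 FILE 2 (H2), brick TT16 (column side): **THE DRESSED MIXED
# BI-VERTEX SPLIT — the bm-dressed field–multiplier bi-vertex of ANY packed kernel is the smooth-column one minus ONE gauge function against the fine divergence of the
# multiplier-vertex family; under the mixed slot letter that correction is the multiplier half of the OWNER's `Wmix`** (the mixed twin of `DressedVertex2Split` ∕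
# `ColumnGaugeSecondOrder`; the column twin of leaf-03 g30's face-side TT13 `SymCorrectorMixedGauge`); plus the `dM`-level first order

HONEST DEPENDENCY (cell records, verbatim): «continuum YM on T⁴ ⇐ BetaPertH ∧ nine spine estimates (0/9 proved); BetaPertH ⇐ (D1) ∧ (D4) ∧
CAP+tail; G-an2-4 gates asym, D1 and NE2/3/4.»  HONEST FRAMING (cell contract, verbatim): «discharging `BetaPertH` makes Bałaban's UV stability
UNCONDITIONAL — a real constructive-QFT result; it is NOT the continuum limit and NOT the Clay problem.»  THIS MODULE is [folklore] `tsum` bookkeeping BY NAME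
over an2's `SecondOrderResponse.mixOfK ∕ vertexOfM ∕ colM ∕ dM ∕ biLoc_vertexOfM_slice ∕ LocStencilFM`, an1's `WardLocusInduction.coDressKBmAt_inr_inr` (co-dressing does not touch
the multiplier block), leaf-01 g29's `DressedVertexSplit`, part 1∕2 `DressedVertex2Split` (summability of the gauge function), the OWNER d1-p2 g23's `ColumnGaugeGenerator`,
leaf-03 g30's TT13 `SymCorrectorMixedGauge.vertexOfM_conjV_diagK_fixed`; the mixed slot letter `hM` and the first-order letter `hS` are HYPOTHESES — which tables obey them is the
OWNER's instance.  No `def`, no `def … : Prop`, nothing cited, NO printed hypothesis, 0 sorry.  0 root-level binders of row D1 discharged (hW ∕ hR-sockets ∕ hSX-socket ∕ D1Tel ∕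
D1Rep = 0); (K) NOT closed; (J1) ONE OPEN ROW; NOT D1, NEVER «G-an2-4 closed», NOT `BetaPertH`, NOT continuum, NOT Clay.

ABSOLUTE RULE (cell charter, verbatim): «No internally-minted statement may enter as a cited fact. Every hypothesis is either kernel-proved in
this package or a verbatim quotation of a PUBLISHED theorem with page reference. The manuscript(s) under audit are NOT citable for their own
disputed steps — they are the thing under adjudication; programme-internal (2001/route/tribunal) claims are never citable.»

THE MATHEMATICS (dimension `d + 1`; `K′ := coDressKBmAt ρ N K`, `ρ = toSite r` in-block, `N ≥ 1`; `χ := bmGaugeAt ρ (colH K N μ y) N`; `A_M κ u := vertexOfM K N (M₂ κ u) ν y′` the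
multiplier-vertex family of a field–multiplier table `M₂`; `V_M := vertexOfM K N M`).
* §1 [folklore] the multiplier-column vertex is NOT dressed (`vertexOfM_coDress_eq`, from an1's `coDressKBmAt_inr_inr` ∕ `KernelWardMColumn.colM_coDressKBmAt`); `A_M` is a `LocStencil` family
  (`exists_locStencil_sliceVertexM`); linearity of `vertexOfM K N · ν y′` (entrywise summabilities).
* §2 [folklore] LETTER-FREE **`mixOfK K′ N M₂ μ y ν y′ = mixOfK K N M₂ μ y ν y′ − wsum χ (divV A_M)`** (`mixOfK_coDressKBmAt_eq_sub`: ONE outer `DressedVertexSplit`; the inner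
  multiplier vertex is untouched) and the divergence socket `divV A_M w = vertexOfM K N (ρ′ w′ ↦ divV (κ u ↦ M₂ κ u ρ′ w′) w) ν y′` (`divV_sliceVertexM_eq`).
* §3 UNDER THE MIXED LETTER `hM : divV (κ u ↦ M₂ κ u ρ′ w′) w = ξ • conjV (M ρ′ w′) (diagK (legInd ρ w))` (HYPOTHESIS; leaf-03's (LM)): `divV A_M w = ξ • conjV (V_M ν y′) (diagK (legInd ρ w))`,
  `wsum χ (divV A_M) = conjV (V_M ν y′) Λ[χ]`, **`mixOfK K′ N M₂ μ y ν y′ = mixOfK K N M₂ μ y ν y′ + (Λ[χ]∘V_M ν y′ − V_M ν y′∘Λ[χ])`** (`mixOfK_coDressKBmAt_eq_add_comm`),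
  `Λ[χ] := diagK (z b ↦ ξ·χ (legSite ρ z b))`, and BOTH BOND ORDERS summed: `mixOfK K′ … μ y ν y′ + mixOfK K′ … ν y′ μ y = (mixOfK K … μ y ν y′ + mixOfK K … ν y′ μ y)
  + ((Λ[χ′]∘V_M μ y − V_M μ y∘Λ[χ′]) + (Λ[χ]∘V_M ν y′ − V_M ν y′∘Λ[χ]))` — the MULTIPLIER HALF of `ColumnGaugeInvariance.hessKer_columnGauge`'s `Wmix` at `V := V_M`
  (with `ColumnGaugeSecondOrder` §4's FIELD half: `Wmix` at `V := dM K N S M = V_S + V_M`, an2's `SecondOrderResponse.dM`).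
* §4 the `dM`-level first order under `hS : divV S w = ξ • conjV 𝕄 (diagK (legInd ρ w))`: `dM K′ N S M μ y = dM K N S M μ y + (Λ[χ]∘𝕄 − 𝕄∘Λ[χ])` (`dM_coDressKBmAt_eq_add_comm`).
* §5 CAPSTONE — THE TABLE PART OF an2's `W2OfK` (`vertex2OfK + mixOfK + mixOfK`-swapped; the response word apart): under `hL`, `hR` (bi-table `S₂` vs `S`), `hS` (`S` vs `𝕄`), `hM`
  (`M₂` vs `M`), ONE lock `ξ`, ONE generator family `Λ`: **`W2tab K′ μ y ν y′ = W2tab K μ y ν y′ + ((Wmix at V := dM K N S M) + Wgg)`** (`W2tab_coDressKBmAt_eq_add_Wmix_Wgg`) — with §4 the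
  EXACT `(V + G, W + (Wmix + Wgg))` input pair of `ColumnGaugeInvariance.hessKer_columnGauge_of_relInv` ∕ the OWNER g24's `ColumnGaugeTwoPins.hessKer_columnGauge_regroup` for the
  Lagrangian-chart families `V := dM K N S M`, `W := W2tab K` (+ the HEAD's `Nr`).
NOT in this file: the response word `dM (K2OfK K′ N S M ν y′) N S M μ y` of `W2OfK` (the HEAD's `Nr` bookkeeping); the instance.
Unit `b2b-balaban-beta-d1-formalise-leaf-01` (gen 31), D1 formalisation swarm LEAF PROVER 01, road «BF-x»; OFFER O-1 (journal) on leaf-03 g30's INTENT-5 (4) ∕ W-3 «on word».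
Not in print; our bookkeeping.  No existing file touched.
-/

noncomputable section

namespace Summit.QuantumFields.BalabanUV.Beta.D1BFx.DressedMixVertexSplit

open Finset
open scoped BigOperators
open Literature.MathematicalPhysics.QuantumFieldTheory
open Literature.MathematicalPhysics.QuantumFieldTheory.LatticeForm (quo)
open Literature.MathematicalPhysics.QuantumFieldTheory.Balaban1983to89
open Literature.MathematicalPhysics.QuantumFieldTheory.Balaban1983to89.Beta
open B12Sec2to5 (l1 l1_nonneg)
open B4ContourShift (supNorm)
open ExpKernelCalculus (MKer BiLoc Decays comp Zl Zl_nonneg)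
open KernelWard (divV)
open B6BondElimination (unitVec)
open AffineAveraging (Site box toSite)
open OneStepResolventKernel (Fib wsum LocStencil decays_mono)
open OneStepKernelFamily (colH vertexOfK)
open InterLevelTransport (cwsum cwsum_apply)
open BalabanCompositeJets (LocStencil₂)
open SecondOrderResponse (colM vertexOfM dM vertex2OfK mixOfK LocStencilFM biLoc_vertexOfM_slice)
open Summit.QuantumFields.BalabanUV.Beta.ChartConjugation (conjV)
open Summit.QuantumFields.BalabanUV.Beta.BorderedHessian (diagK comp_diagK_left comp_diagK_right)
open Summit.QuantumFields.BalabanUV.Beta.AveragingWardRootedStencils (legSite legInd)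
open Summit.QuantumFields.BalabanUV.Beta.AxialDressingRooted (coDressKBmAt)
open Summit.QuantumFields.BalabanUV.Beta.AxialProjectorBlockMean (bmGaugeAt)
open Summit.QuantumFields.BalabanUV.Beta.WardLocusInduction (coDressKBmAt_inr_inr)
open Summit.QuantumFields.BalabanUV.Beta.SecondOrderSplitDecay (summable_colM_mul_bdd)
open Summit.QuantumFields.BalabanUV.Beta.SecondOrderRemainderTables (abs_le_of_locStencilFM)
open Summit.QuantumFields.BalabanUV.Beta.SecondOrderContactForm (diagK_comp_add add_comp_diagK)
open Summit.QuantumFields.BalabanUV.Beta.D1BFx.DressedVertexSplit (vertexOfK_coDressKBmAt_eq_sub)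
open Summit.QuantumFields.BalabanUV.Beta.D1BFx.DressedVertex2Split (summable_abs_bmGaugeAt)
open Summit.QuantumFields.BalabanUV.Beta.D1BFx.ColumnGaugeGenerator (wsum_divV_eq_conjV_of_letters_smul)
open Summit.QuantumFields.BalabanUV.Beta.SymCorrectorPairGauge (smul_conjV_diagK')
open Summit.QuantumFields.BalabanUV.Beta.SymCorrectorMixedGauge (vertexOfM_conjV_diagK_fixed)
open Summit.QuantumFields.BalabanUV.Beta.D1BFx.ColumnGaugeSecondOrder (vertex2OfK_coDressKBmAt_eq_add_Wmix_Wgg_one)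

variable {d : ℕ}

/-! ## §1 The multiplier side is not dressed; the multiplier-vertex family is a `LocStencil` family; linearity of `vertexOfM` -/

/-- [folklore] **THE MULTIPLIER-COLUMN VERTEX IS NOT DRESSED**: `vertexOfM (coDressKBmAt ρ N K) N M μ y = vertexOfM K N M μ y` — co-dressing does not touch the multiplier
columns (an1's `WardLocusInduction.coDressKBmAt_inr_inr`; the `colM` form is an1's `KernelWardMColumn.colM_coDressKBmAt`, used here through the entry lemma to keep the imports small). -/
theorem vertexOfM_coDress_eq (ρ : Site (d + 1)) (N : ℕ) (K : MKer (d + 1) (Fib d)) (M : Fin (d + 1) → Site (d + 1) → MKer (d + 1) (Fib d)) (μ : Fin (d + 1))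
    (y : Site (d + 1)) : vertexOfM (coDressKBmAt ρ N K) N M μ y = vertexOfM K N M μ y := by
  funext x z a b
  simp only [vertexOfM]
  refine Finset.sum_congr rfl fun ρ' _ => ?_
  have e : colM (coDressKBmAt ρ N K) N μ y ρ' = colM K N μ y ρ' := funext fun w => coDressKBmAt_inr_inr ρ N K _ _ _ _
  rw [e]

/-- [folklore] **THE MULTIPLIER-VERTEX FAMILY OF A `LocStencilFM` TABLE THROUGH A DECAYING KERNEL IS A `LocStencil` FAMILY**: `κ u ↦ vertexOfM K N (M₂ κ u) ν y′` is bi-localised at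
`(u, u)` with SOME constant and positive rate (an2's `biLoc_vertexOfM_slice` at the common rate `min δ_K δ₂`, far-centre factor dropped). -/
theorem exists_locStencil_sliceVertexM {N : ℕ} [NeZero N] {K : MKer (d + 1) (Fib d)} (hK : ∃ δ C : ℝ, 0 < δ ∧ 0 ≤ C ∧ Decays K C δ)
    {M₂ : Fin (d + 1) → Site (d + 1) → Fin (d + 1) → Site (d + 1) → MKer (d + 1) (Fib d)} {C₂ δ₂ : ℝ} (hM₂ : LocStencilFM N M₂ C₂ δ₂) (hδ₂ : 0 < δ₂)
    (ν : Fin (d + 1)) (y' : Site (d + 1)) :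
    ∃ CA δA : ℝ, 0 < δA ∧ LocStencil (fun κ u => vertexOfM K N (M₂ κ u) ν y') CA δA := by
  obtain ⟨δK, C, hδK, hC, hKd⟩ := hK
  set m : ℝ := min δK δ₂ with hm
  have hmpos : 0 < m := lt_min hδK hδ₂
  have hKm : Decays K C m := decays_mono hKd hC le_rfl (min_le_left _ _)
  have hMm : LocStencilFM N M₂ C₂ m := hM₂.mono (min_le_right _ _)
  have hC₂ : 0 ≤ C₂ := hM₂.nonneg
  refine ⟨(d + 1 : ℕ) * (C * C₂ * Zl (d + 1) (m / 2)), m, hmpos, fun κ u x z a b => ?_⟩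
  have h := biLoc_vertexOfM_slice (N := N) hKm hC hMm hmpos κ u ν y' x z a b
  refine h.trans (mul_le_mul_of_nonneg_right ?_ (Real.exp_pos _).le)
  have hZ := Zl_nonneg (D := d + 1) (half_pos hmpos)
  have h0 : 0 ≤ (d + 1 : ℕ) * (C * C₂ * Zl (d + 1) (m / 2)) := by positivity
  have he : Real.exp (-(m / 2) * l1 (u - (N : ℤ) • y')) ≤ 1 := Real.exp_le_one_iff.2 (by nlinarith [l1_nonneg (u - (N : ℤ) • y')])
  calc ((d + 1 : ℕ) : ℝ) * (C * C₂ * Zl (d + 1) (m / 2) * Real.exp (-(m / 2) * l1 (u - (N : ℤ) • y')))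
      = (d + 1 : ℕ) * (C * C₂ * Zl (d + 1) (m / 2)) * Real.exp (-(m / 2) * l1 (u - (N : ℤ) • y')) := by ring
    _ ≤ (d + 1 : ℕ) * (C * C₂ * Zl (d + 1) (m / 2)) * 1 := mul_le_mul_of_nonneg_left he h0
    _ = _ := mul_one _

/-- [folklore] Subtractivity of the multiplier-column vertex in the table slot (entrywise summabilities). -/
theorem vertexOfM_sub_of_summable {N : ℕ} [NeZero N] (K : MKer (d + 1) (Fib d)) {P Q : Fin (d + 1) → Site (d + 1) → MKer (d + 1) (Fib d)} (ν : Fin (d + 1)) (y' : Site (d + 1))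
    (hP : ∀ (ρ' : Fin (d + 1)) (x z : Site (d + 1)) (a b : Fib d), Summable fun w => colM K N ν y' ρ' w * P ρ' w x z a b)
    (hQ : ∀ (ρ' : Fin (d + 1)) (x z : Site (d + 1)) (a b : Fib d), Summable fun w => colM K N ν y' ρ' w * Q ρ' w x z a b) :
    vertexOfM K N (fun ρ' w => P ρ' w - Q ρ' w) ν y' = vertexOfM K N P ν y' - vertexOfM K N Q ν y' := by
  funext x z a b
  simp only [vertexOfM, cwsum_apply, Pi.sub_apply, mul_sub]
  rw [← Finset.sum_sub_distrib]
  exact Finset.sum_congr rfl fun ρ' _ => (hP ρ' x z a b).tsum_sub (hQ ρ' x z a b)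

/-- [folklore] The multiplier-column vertex is additive over a finite family in the table slot (entrywise summabilities). -/
theorem vertexOfM_finset_sum_of_summable {N : ℕ} [NeZero N] (K : MKer (d + 1) (Fib d)) {ι : Type*} (s : Finset ι) (P : ι → Fin (d + 1) → Site (d + 1) → MKer (d + 1) (Fib d))
    (ν : Fin (d + 1)) (y' : Site (d + 1))
    (hP : ∀ i ∈ s, ∀ (ρ' : Fin (d + 1)) (x z : Site (d + 1)) (a b : Fib d), Summable fun w => colM K N ν y' ρ' w * P i ρ' w x z a b) :
    vertexOfM K N (fun ρ' w => ∑ i ∈ s, P i ρ' w) ν y' = ∑ i ∈ s, vertexOfM K N (P i) ν y' := by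
  funext x z a b
  simp only [vertexOfM, cwsum_apply, Finset.sum_apply, Finset.mul_sum]
  rw [Finset.sum_comm]
  exact Finset.sum_congr rfl fun ρ' _ => Summable.tsum_finsetSum fun i hi => hP i hi ρ' x z a b

/-! ## §2 The letter-free dressed mixed bi-vertex split and its divergence socket -/

section LetterFree

variable {N : ℕ} [NeZero N] (hN : 1 ≤ N) {r : Fin (d + 1) → ℕ} (hr : r ∈ box (d + 1) N) {K : MKer (d + 1) (Fib d)} (hK : ∃ δ C : ℝ, 0 < δ ∧ 0 ≤ C ∧ Decays K C δ)
  {M₂ : Fin (d + 1) → Site (d + 1) → Fin (d + 1) → Site (d + 1) → MKer (d + 1) (Fib d)} {C₂ δ₂ : ℝ} (hM₂ : LocStencilFM N M₂ C₂ δ₂) (hδ₂ : 0 < δ₂)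
  (μ : Fin (d + 1)) (y : Site (d + 1)) (ν : Fin (d + 1)) (y' : Site (d + 1)) {M c : ℝ} (hM : 0 ≤ M) (hc : 0 < c)
  (hKμ : ∀ κ u, |colH K N μ y κ u| ≤ M * Real.exp (-(c * supNorm (quo N u - y))))

include hN hr hK hM₂ hδ₂ hM hc hKμ in
/-- [folklore] **THE DRESSED MIXED BI-VERTEX SPLIT**: `mixOfK K′ N M₂ μ y ν y′ = mixOfK K N M₂ μ y ν y′ − wsum χ (divV (κ u ↦ vertexOfM K N (M₂ κ u) ν y′))` — the inner multiplier
vertex is not dressed (§1), the outer field column splits by leaf-01 g29's `DressedVertexSplit` on the `LocStencil` family `A_M`. -/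
theorem mixOfK_coDressKBmAt_eq_sub :
    mixOfK (coDressKBmAt (toSite r) N K) N M₂ μ y ν y'
      = mixOfK K N M₂ μ y ν y' - wsum (bmGaugeAt (toSite r) (colH K N μ y) N) (divV fun κ u => vertexOfM K N (M₂ κ u) ν y') := by
  obtain ⟨CA, δA, hδA, hA⟩ := exists_locStencil_sliceVertexM (N := N) hK hM₂ hδ₂ ν y'
  have inner : (fun κ u => vertexOfM (coDressKBmAt (toSite r) N K) N (M₂ κ u) ν y') = fun κ u => vertexOfM K N (M₂ κ u) ν y' :=
    funext fun κ => funext fun u => vertexOfM_coDress_eq (toSite r) N K (M₂ κ u) ν y'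
  unfold mixOfK
  rw [inner, vertexOfK_coDressKBmAt_eq_sub hN hr K hA hδA μ y hM hc hKμ]

include hK hM₂ hδ₂ in
/-- [folklore] **THE FINE DIVERGENCE OF THE MULTIPLIER-VERTEX FAMILY IS THE MULTIPLIER VERTEX OF THE FIELD-SLOT DIVERGENCES** (no letters):
`divV (κ u ↦ vertexOfM K N (M₂ κ u) ν y′) w = vertexOfM K N (ρ′ w′ ↦ divV (κ u ↦ M₂ κ u ρ′ w′) w) ν y′`. -/
theorem divV_sliceVertexM_eq (w : Site (d + 1)) :
    divV (fun κ u => vertexOfM K N (M₂ κ u) ν y') w = vertexOfM K N (fun ρ' w' => divV (fun κ u => M₂ κ u ρ' w') w) ν y' := by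
  have hB : ∀ κ u ρ' w' x z a b, |M₂ κ u ρ' w' x z a b| ≤ C₂ := fun κ u ρ' w' x z a b => abs_le_of_locStencilFM hM₂ hδ₂.le κ u ρ' w' x z a b
  have hs : ∀ (κ : Fin (d + 1)) (u : Site (d + 1)) (ρ' : Fin (d + 1)) (x z : Site (d + 1)) (a b : Fib d),
      Summable fun w' => colM K N ν y' ρ' w' * M₂ κ u ρ' w' x z a b :=
    fun κ u ρ' x z a b => summable_colM_mul_bdd (N := N) hK (fun w' => hB κ u ρ' w' x z a b) ν y' ρ'
  calc divV (fun κ u => vertexOfM K N (M₂ κ u) ν y') w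
      = ∑ κ : Fin (d + 1), (vertexOfM K N (M₂ κ (w - unitVec κ)) ν y' - vertexOfM K N (M₂ κ w) ν y') := by simp only [KernelWard.divV]
    _ = ∑ κ : Fin (d + 1), vertexOfM K N (fun ρ' w' => M₂ κ (w - unitVec κ) ρ' w' - M₂ κ w ρ' w') ν y' :=
        Finset.sum_congr rfl fun κ _ =>
          (vertexOfM_sub_of_summable K ν y' (fun ρ' x z a b => hs κ _ ρ' x z a b) (fun ρ' x z a b => hs κ w ρ' x z a b)).symm
    _ = vertexOfM K N (fun ρ' w' => ∑ κ : Fin (d + 1), (M₂ κ (w - unitVec κ) ρ' w' - M₂ κ w ρ' w')) ν y' :=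
        (vertexOfM_finset_sum_of_summable K Finset.univ (fun κ ρ' w' => M₂ κ (w - unitVec κ) ρ' w' - M₂ κ w ρ' w') ν y'
          (fun κ _ ρ' x z a b => by simpa only [Pi.sub_apply, mul_sub] using (hs κ _ ρ' x z a b).sub (hs κ w ρ' x z a b))).symm
    _ = vertexOfM K N (fun ρ' w' => divV (fun κ u => M₂ κ u ρ' w') w) ν y' := by simp only [KernelWard.divV]

end LetterFree

/-! ## §3 Under the mixed slot letter: the correction is the multiplier half of the OWNER's `Wmix` -/

section Letters

variable {N : ℕ} [NeZero N] (hN : 1 ≤ N) {r : Fin (d + 1) → ℕ} (hr : r ∈ box (d + 1) N) {K : MKer (d + 1) (Fib d)} (hK : ∃ δ C : ℝ, 0 < δ ∧ 0 ≤ C ∧ Decays K C δ)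
  {M₂ : Fin (d + 1) → Site (d + 1) → Fin (d + 1) → Site (d + 1) → MKer (d + 1) (Fib d)} {C₂ δ₂ : ℝ} (hM₂ : LocStencilFM N M₂ C₂ δ₂) (hδ₂ : 0 < δ₂)
  (μ : Fin (d + 1)) (y : Site (d + 1)) (ν : Fin (d + 1)) (y' : Site (d + 1)) {M c : ℝ} (hM : 0 ≤ M) (hc : 0 < c)
  (hKμ : ∀ κ u, |colH K N μ y κ u| ≤ M * Real.exp (-(c * supNorm (quo N u - y))))
  (hKν : ∀ κ u, |colH K N ν y' κ u| ≤ M * Real.exp (-(c * supNorm (quo N u - y'))))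
  {Mt : Fin (d + 1) → Site (d + 1) → MKer (d + 1) (Fib d)} {ρ : Site (d + 1)} {ξ : ℝ}
  (hLM : ∀ ρ' w' w, divV (fun κ u => M₂ κ u ρ' w') w = ξ • conjV (Mt ρ' w') (diagK (legInd ρ w)))

include hK hM₂ hδ₂ hLM in
/-- [folklore] **THE MULTIPLIER-VERTEX FAMILY OBEYS A FIRST-ORDER LETTER**: under `hM`, `divV (κ u ↦ vertexOfM K N (M₂ κ u) ν y′) w = ξ • conjV (vertexOfM K N M ν y′) (diagK (legInd ρ w))`
(§2's socket + TT13's `vertexOfM_conjV_diagK_fixed`). -/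
theorem divV_sliceVertexM_eq_of_letter (w : Site (d + 1)) :
    divV (fun κ u => vertexOfM K N (M₂ κ u) ν y') w = ξ • conjV (vertexOfM K N Mt ν y') (diagK (legInd ρ w)) := by
  rw [divV_sliceVertexM_eq hK hM₂ hδ₂ ν y' w]
  have e : (fun ρ' w' => divV (fun κ u => M₂ κ u ρ' w') w) = fun ρ' w' => conjV (Mt ρ' w') (diagK fun z b => ξ * legInd ρ w z b) := by
    funext ρ' w'; rw [hLM ρ' w' w, smul_conjV_diagK']
  rw [e, vertexOfM_conjV_diagK_fixed, smul_conjV_diagK']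

include hK hM₂ hδ₂ hLM in
/-- [folklore] **ITS GAUGE CORRECTION IS A CONTACT OF `V_M`**: for every weight `χ`, `wsum χ (divV (κ u ↦ vertexOfM K N (M₂ κ u) ν y′)) = conjV (vertexOfM K N M ν y′) (diagK (ξ·χ∘legSite ρ))`
(the OWNER's `wsum_divV_eq_conjV_of_letters_smul`). -/
theorem wsum_divV_sliceVertexM_eq_of_letter (χ : Site (d + 1) → ℝ) :
    wsum χ (divV fun κ u => vertexOfM K N (M₂ κ u) ν y') = conjV (vertexOfM K N Mt ν y') (diagK fun z b => ξ * χ (legSite ρ z b)) :=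
  wsum_divV_eq_conjV_of_letters_smul (fun w => divV_sliceVertexM_eq_of_letter hK hM₂ hδ₂ ν y' hLM w) χ

include hN hr hK hM₂ hδ₂ hM hc hKμ hLM in
/-- [folklore] **THE DRESSED MIXED BI-VERTEX UNDER THE LETTER** (`conjV` form): `mixOfK K′ N M₂ μ y ν y′ = mixOfK K N M₂ μ y ν y′ − conjV (V_M ν y′) Λ[χ_{μ,y}]`,
`Λ[χ] := diagK (z b ↦ ξ·χ (legSite ρ z b))`, `χ_{μ,y} := bmGaugeAt (toSite r) (colH K N μ y) N`. -/
theorem mixOfK_coDressKBmAt_eq_of_letter :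
    mixOfK (coDressKBmAt (toSite r) N K) N M₂ μ y ν y'
      = mixOfK K N M₂ μ y ν y' - conjV (vertexOfM K N Mt ν y') (diagK fun z b => ξ * bmGaugeAt (toSite r) (colH K N μ y) N (legSite ρ z b)) := by
  rw [mixOfK_coDressKBmAt_eq_sub hN hr hK hM₂ hδ₂ μ y ν y' hM hc hKμ, wsum_divV_sliceVertexM_eq_of_letter hK hM₂ hδ₂ ν y' hLM]

include hN hr hK hM₂ hδ₂ hM hc hKμ hLM in
/-- [folklore] **THE SAME IN THE OWNER's ORIENTATION**: `mixOfK K′ N M₂ μ y ν y′ = mixOfK K N M₂ μ y ν y′ + (Λ[χ_{μ,y}]∘V_M ν y′ − V_M ν y′∘Λ[χ_{μ,y}])` — the `(μ,y; ν,y′)` bond order's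
half of `hessKer_columnGauge`'s `Wmix` summand `[Λ μ y, V ν y′]` at `V := V_M`. -/
theorem mixOfK_coDressKBmAt_eq_add_comm :
    mixOfK (coDressKBmAt (toSite r) N K) N M₂ μ y ν y'
      = mixOfK K N M₂ μ y ν y'
        + (comp (diagK fun z b => ξ * bmGaugeAt (toSite r) (colH K N μ y) N (legSite ρ z b)) (vertexOfM K N Mt ν y')
          - comp (vertexOfM K N Mt ν y') (diagK fun z b => ξ * bmGaugeAt (toSite r) (colH K N μ y) N (legSite ρ z b))) := by
  rw [mixOfK_coDressKBmAt_eq_of_letter hN hr hK hM₂ hδ₂ μ y ν y' hM hc hKμ hLM]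
  unfold ChartConjugation.conjV
  abel

include hN hr hK hM₂ hδ₂ hM hc hKμ hKν hLM in
/-- [folklore] **BOTH BOND ORDERS: THE MULTIPLIER HALF OF `Wmix`** — `mixOfK K′ … μ y ν y′ + mixOfK K′ … ν y′ μ y = (mixOfK K … μ y ν y′ + mixOfK K … ν y′ μ y)
+ ((Λ[χ_{ν,y′}]∘V_M μ y − V_M μ y∘Λ[χ_{ν,y′}]) + (Λ[χ_{μ,y}]∘V_M ν y′ − V_M ν y′∘Λ[χ_{μ,y}]))`, i.e. `hessKer_columnGauge`'s `(comp (Λ ν y′) (V μ y) − comp (V μ y) (Λ ν y′)) +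
(comp (Λ μ y) (V ν y′) − comp (V ν y′) (Λ μ y))` at `V := V_M = vertexOfM K N M` (the multiplier summand of an2's `dM K N S M = V_S + V_M`). -/
theorem mixOfK_add_swap_coDressKBmAt_eq :
    mixOfK (coDressKBmAt (toSite r) N K) N M₂ μ y ν y' + mixOfK (coDressKBmAt (toSite r) N K) N M₂ ν y' μ y
      = (mixOfK K N M₂ μ y ν y' + mixOfK K N M₂ ν y' μ y)
        + ((comp (diagK fun z b => ξ * bmGaugeAt (toSite r) (colH K N ν y') N (legSite ρ z b)) (vertexOfM K N Mt μ y)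
              - comp (vertexOfM K N Mt μ y) (diagK fun z b => ξ * bmGaugeAt (toSite r) (colH K N ν y') N (legSite ρ z b)))
          + (comp (diagK fun z b => ξ * bmGaugeAt (toSite r) (colH K N μ y) N (legSite ρ z b)) (vertexOfM K N Mt ν y')
              - comp (vertexOfM K N Mt ν y') (diagK fun z b => ξ * bmGaugeAt (toSite r) (colH K N μ y) N (legSite ρ z b)))) := by
  rw [mixOfK_coDressKBmAt_eq_add_comm hN hr hK hM₂ hδ₂ μ y ν y' hM hc hKμ hLM, mixOfK_coDressKBmAt_eq_add_comm hN hr hK hM₂ hδ₂ ν y' μ y hM hc hKν hLM]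
  abel

end Letters

/-! ## §4 The `dM`-level first order: the field half splits, the multiplier half is untouched -/

section FirstOrder

variable {N : ℕ} (hN : 1 ≤ N) {r : Fin (d + 1) → ℕ} (hr : r ∈ box (d + 1) N) (K : MKer (d + 1) (Fib d))
  {S : Fin (d + 1) → Site (d + 1) → MKer (d + 1) (Fib d)} {Cs δs : ℝ} (hS : LocStencil S Cs δs) (hδs : 0 < δs)
  (M : Fin (d + 1) → Site (d + 1) → MKer (d + 1) (Fib d)) (μ : Fin (d + 1)) (y : Site (d + 1)) {Mb c : ℝ} (hMb : 0 ≤ Mb) (hc : 0 < c)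
  (hKμ : ∀ κ u, |colH K N μ y κ u| ≤ Mb * Real.exp (-(c * supNorm (quo N u - y))))
include hN hr hS hδs hMb hc hKμ

/-- [folklore] **THE DRESSED LAGRANGIAN-CHART DERIVATIVE, LETTER-FREE**: `dM K′ N S M μ y = dM K N S M μ y − wsum χ_{μ,y} (divV S)` (g29's split on the field half `vertexOfK`, §1 on the
multiplier half `vertexOfM`). -/
theorem dM_coDressKBmAt_eq_sub :
    dM (coDressKBmAt (toSite r) N K) N S M μ y = dM K N S M μ y - wsum (bmGaugeAt (toSite r) (colH K N μ y) N) (divV S) := by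
  unfold dM
  rw [vertexOfK_coDressKBmAt_eq_sub hN hr K hS hδs μ y hMb hc hKμ, vertexOfM_coDress_eq]
  abel

/-- [folklore] **UNDER THE FIRST-ORDER LETTER** `hS : divV S w = ξ • conjV 𝕄 (diagK (legInd ρ w))` (the native spine's shape `ColumnGaugeGenerator.divV_S0NAt_eq_smul_conjV`; HYPOTHESIS):
`dM K′ N S M μ y = dM K N S M μ y + (Λ[χ_{μ,y}]∘𝕄 − 𝕄∘Λ[χ_{μ,y}])`, `Λ[χ] := diagK (z b ↦ ξ·χ (legSite ρ z b))` — the `V + G` of `ColumnGaugeInvariance.hessKer_columnGauge_of_relInv` for the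
full first-order family `V := dM K N S M`. -/
theorem dM_coDressKBmAt_eq_add_comm {𝕄 : MKer (d + 1) (Fib d)} {ρ : Site (d + 1)} {ξ : ℝ} (hSl : ∀ w, divV S w = ξ • conjV 𝕄 (diagK (legInd ρ w))) :
    dM (coDressKBmAt (toSite r) N K) N S M μ y
      = dM K N S M μ y
        + (comp (diagK fun z b => ξ * bmGaugeAt (toSite r) (colH K N μ y) N (legSite ρ z b)) 𝕄
          - comp 𝕄 (diagK fun z b => ξ * bmGaugeAt (toSite r) (colH K N μ y) N (legSite ρ z b))) := by
  rw [dM_coDressKBmAt_eq_sub hN hr K hS hδs M μ y hMb hc hKμ,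
    show wsum (bmGaugeAt (toSite r) (colH K N μ y) N) (divV S) = wsum (bmGaugeAt (toSite r) (colH K N μ y) N) (fun w => divV S w) from rfl,
    wsum_divV_eq_conjV_of_letters_smul hSl]
  abel

end FirstOrder

/-! ## §5 Capstone: the table part of `W2OfK` transforms by `Wmix(dM) + Wgg` with ONE generator family -/

section Capstone

variable {N : ℕ} [NeZero N] (hN : 1 ≤ N) {r : Fin (d + 1) → ℕ} (hr : r ∈ box (d + 1) N) {K : MKer (d + 1) (Fib d)} (hK : ∃ δ C : ℝ, 0 < δ ∧ 0 ≤ C ∧ Decays K C δ)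
  {S₂ : Fin (d + 1) → Site (d + 1) → Fin (d + 1) → Site (d + 1) → MKer (d + 1) (Fib d)} {C₂ δ₂ : ℝ} (hS₂ : LocStencil₂ S₂ C₂ δ₂) (hδ₂ : 0 < δ₂)
  {M₂ : Fin (d + 1) → Site (d + 1) → Fin (d + 1) → Site (d + 1) → MKer (d + 1) (Fib d)} {Cm δm : ℝ} (hM₂ : LocStencilFM N M₂ Cm δm) (hδm : 0 < δm)
  (μ : Fin (d + 1)) (y : Site (d + 1)) (ν : Fin (d + 1)) (y' : Site (d + 1)) {Mb c : ℝ} (hMb : 0 ≤ Mb) (hc : 0 < c)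
  (hKμ : ∀ κ u, |colH K N μ y κ u| ≤ Mb * Real.exp (-(c * supNorm (quo N u - y))))
  (hKν : ∀ κ u, |colH K N ν y' κ u| ≤ Mb * Real.exp (-(c * supNorm (quo N u - y'))))
  {S M : Fin (d + 1) → Site (d + 1) → MKer (d + 1) (Fib d)} {𝕄 : MKer (d + 1) (Fib d)} {ρ : Site (d + 1)} {ξ : ℝ}
  (hL : ∀ κ' u' w, divV (fun κ u => S₂ κ u κ' u') w = ξ • conjV (S κ' u') (diagK (legInd ρ w)))
  (hR : ∀ α x w', divV (S₂ α x) w' = ξ • conjV (S α x) (diagK (legInd ρ w')))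
  (hS : ∀ w', divV S w' = ξ • conjV 𝕄 (diagK (legInd ρ w')))
  (hLM : ∀ ρ' w' w, divV (fun κ u => M₂ κ u ρ' w') w = ξ • conjV (M ρ' w') (diagK (legInd ρ w)))
include hN hr hK hS₂ hδ₂ hM₂ hδm hMb hc hKμ hKν hL hR hS hLM

/-- [folklore] **THE TABLE PART OF THE SECOND-ORDER LAGRANGIAN-CHART FAMILY TRANSFORMS BY `Wmix(dM) + Wgg`**: with `Λ b := diagK (ξ·χ_b∘legSite ρ)` (ONE family, both bonds),
`V := dM K N S M = vertexOfK K N S + vertexOfM K N M` (an2's `SecondOrderResponse.dM`), `G ν y′ := Λ ν y′∘𝕄 − 𝕄∘Λ ν y′`,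
`(vertex2OfK K′ N S₂ + mixOfK K′ N M₂ + mixOfK K′ N M₂ ∘swap) μ y ν y′ = (the same at K) + (((Λ ν y′∘V μ y − V μ y∘Λ ν y′) + (Λ μ y∘V ν y′ − V ν y′∘Λ μ y)) + (Λ μ y∘G ν y′ − G ν y′∘Λ μ y))`
— `ColumnGaugeSecondOrder` §4 (field half + `Wgg`) + §3 (multiplier half), distributed over `dM = V_S + V_M` (an2's `diagK_comp_add` ∕ `add_comp_diagK`). -/
theorem W2tab_coDressKBmAt_eq_add_Wmix_Wgg :
    vertex2OfK (coDressKBmAt (toSite r) N K) N S₂ μ y ν y' + mixOfK (coDressKBmAt (toSite r) N K) N M₂ μ y ν y'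
        + mixOfK (coDressKBmAt (toSite r) N K) N M₂ ν y' μ y
      = (vertex2OfK K N S₂ μ y ν y' + mixOfK K N M₂ μ y ν y' + mixOfK K N M₂ ν y' μ y)
        + (((comp (diagK fun z b => ξ * bmGaugeAt (toSite r) (colH K N ν y') N (legSite ρ z b)) (dM K N S M μ y)
              - comp (dM K N S M μ y) (diagK fun z b => ξ * bmGaugeAt (toSite r) (colH K N ν y') N (legSite ρ z b)))
            + (comp (diagK fun z b => ξ * bmGaugeAt (toSite r) (colH K N μ y) N (legSite ρ z b)) (dM K N S M ν y')
              - comp (dM K N S M ν y') (diagK fun z b => ξ * bmGaugeAt (toSite r) (colH K N μ y) N (legSite ρ z b))))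
          + (comp (diagK fun z b => ξ * bmGaugeAt (toSite r) (colH K N μ y) N (legSite ρ z b))
                (comp (diagK fun z b => ξ * bmGaugeAt (toSite r) (colH K N ν y') N (legSite ρ z b)) 𝕄
                  - comp 𝕄 (diagK fun z b => ξ * bmGaugeAt (toSite r) (colH K N ν y') N (legSite ρ z b)))
            - comp (comp (diagK fun z b => ξ * bmGaugeAt (toSite r) (colH K N ν y') N (legSite ρ z b)) 𝕄
                  - comp 𝕄 (diagK fun z b => ξ * bmGaugeAt (toSite r) (colH K N ν y') N (legSite ρ z b)))
                (diagK fun z b => ξ * bmGaugeAt (toSite r) (colH K N μ y) N (legSite ρ z b)))) := by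
  rw [vertex2OfK_coDressKBmAt_eq_add_Wmix_Wgg_one hN hr hK hS₂ hδ₂ μ y ν y' hMb hc hKμ hKν hL hR hS,
    mixOfK_coDressKBmAt_eq_add_comm hN hr hK hM₂ hδm μ y ν y' hMb hc hKμ hLM, mixOfK_coDressKBmAt_eq_add_comm hN hr hK hM₂ hδm ν y' μ y hMb hc hKν hLM]
  unfold dM
  simp only [diagK_comp_add, add_comp_diagK]
  abel

end Capstone

end Summit.QuantumFields.BalabanUV.Beta.D1BFx.DressedMixVertexSplit

end
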